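import Summits.QuantumFields.YangMills.Theorems.LuscherReductionDressedRitzPolyakovLiftTransplantRoot
import Literature.Analysis.OperatorTheory.YangMillsMatrixModelGroundStateLowerBoundAgmon
import HarnessLib

/-!
# Route `LuscherReduction`, item `DressedRitz` (stmt-QuantumFields-20205), line «polyakovlift» r7 — the VALLEY-RATIO BOUND `C_f(R)` of the transplanted
# observables from the cubic ground-state floor (F9 layer D3 input; fleet seat ym-20205-polyakovlift-s1 gen 3)

Support module (`--supports stmt-QuantumFields-20205`, helper, no closure claim).  The transplanted observable of the line is
`g_i = (χ_R · f_{i+1}/f_0) ∘ rootCoord L (Λ/2)` (`transplantFn`, `transplantObsL`) for an AL1 eigenfamily `f` of Lüscher's matrix Hamiltonian `𝔥` with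
`f_0 > 0`.  The S-PSCAL″ assembly (LEAD g2, 2026-08-27 «LOCATED OBSTRUCTION», r7) needs the size of `C_f(R) := sup |χ_R f_{i+1}/f_0|` as a FUNCTION OF THE
RADIUS, to be played against an `L`-independent floor `e^{−c/Λ}` at `R = Λ^{−1/4}`.  From the Carmona–Simon-type floor
`f_0(y) ≥ c·e^{−a(1+‖y‖)³}` (Literature `groundState_lower_bound_cubic'`, `YangMillsMatrixModelGroundStateLowerBoundAgmon.lean`) and the `ExpDecay₂` clause of
`IsEigenFamily` (`|f_j| ≤ C_j`):

* ★ `exists_ratio_bound` — `∃ M a > 0, ∀ j y, |f_j(y)/f_0(y)| ≤ M·e^{a(1+‖y‖)³}`;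
* `ratio_bound_of_norm_le` — on the ball `‖y‖ ≤ ρ`: `≤ M·e^{a(1+ρ)³}`;
* ★★ `exists_transplantFn_bound` — `∃ M a > 0, ∀ R > 0, ∀ i y, |transplantFn R f i y| ≤ M·e^{a(1+√2·R)³}` (`χ_R ∈ [0,1]`, `χ_R = 0` off `‖y‖² < 2R²`);
* `exists_transplantObsL_bound` — the same bound for the one-site observables `transplantObsL L Λ R f i` (any `L`, `Λ`).

At the r7 radius `R = Λ^{−1/4}` this is `C_f ≤ M·exp(a(1+√2Λ^{−1/4})³) = e^{O(Λ^{−3/4})}`, which beats `e^{−ε/Λ}` for EVERY `ε > 0` as `Λ → 0` (no margin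
condition between the decay rate and the floor constant).

HONEST FRAMING: elementary bookkeeping on the conditional femto rung R2b1 (one stub of one crux); nothing here bears on infinite volume, the continuum limit
or the Clay gap.  References: R. Carmona, B. Simon, CMP 80 (1981) 59 [cite: CarmonaSimon1981]; M. Lüscher, NPB 219 (1983) 233 [cite: Luscher1983, §2–§3].
-/

set_option autoImplicit false

noncomputable section

open MeasureTheory Filter Topology Real
open Literature.MathematicalPhysics.QuantumFieldTheory (GaugeConfig Site gaugeTransform)
open Literature.Analysis.OperatorTheory.YMMatrixModel
open scoped BigOperators

namespace Summit.QuantumFields.YangMills.Theorems.FemtoTransferGap.PolyakovLift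

open Summit.QuantumFields.YangMills.Theorems.FemtoTransferGap

variable {k : ℕ} {f : Fin (k + 1) → ZM → ℝ}

/-- ★ **Valley-ratio bound for an AL1 eigenfamily with positive ground state**: there are `M, a > 0` with
`|f_j(y) / f_0(y)| ≤ M · e^{a(1+‖y‖)³}` for all `j` and `y` — the `ExpDecay₂` bound `|f_j| ≤ C_j` over the cubic Carmona–Simon floor
`f_0 ≥ c e^{−a(1+‖y‖)³}` (`groundState_lower_bound_cubic'`). [cite: CarmonaSimon1981] [cite: Luscher1983, §2–§3] -/
theorem exists_ratio_bound (hf : IsEigenFamily k f) (hpos : ∀ x, 0 < f 0 x) :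
    ∃ M a : ℝ, 0 < M ∧ 0 < a ∧ ∀ (j : Fin (k + 1)) (y : ZM), |f j y / f 0 y| ≤ M * Real.exp (a * (1 + ‖y‖) ^ 3) := by
  obtain ⟨hsmooth, -, -, heig, hdec⟩ := hf
  -- the cubic floor for `f 0`
  obtain ⟨c, a, hc, ha, hfloor⟩ :=
    groundState_lower_bound_cubic' (hsmooth 0 2) hpos (heig 0)
  -- uniform sup bounds for the numerators
  have hb : ∀ j, ∃ C : ℝ, 0 ≤ C ∧ ∀ y, |f j y| ≤ C := fun j => by
    obtain ⟨C, hC⟩ := (hdec j).abs_le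
    exact ⟨max C 0, le_max_right _ _, fun y => (hC y).trans (le_max_left _ _)⟩
  choose Cf hCf0 hCf using hb
  set M₀ : ℝ := ∑ j, Cf j with hM₀
  have hM₀j : ∀ j, Cf j ≤ M₀ := fun j =>
    Finset.single_le_sum (f := Cf) (fun i _ => hCf0 i) (Finset.mem_univ j)
  have hM₀0 : 0 ≤ M₀ := Finset.sum_nonneg fun i _ => hCf0 i
  refine ⟨M₀ / c + 1, a, by positivity, ha, fun j y => ?_⟩
  have hf0 : 0 < f 0 y := hpos y
  have hE : 0 < Real.exp (a * (1 + ‖y‖) ^ 3) := Real.exp_pos _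
  have hEinv : Real.exp (-(a * (1 + ‖y‖) ^ 3)) * Real.exp (a * (1 + ‖y‖) ^ 3) = 1 := by
    rw [← Real.exp_add, neg_add_cancel, Real.exp_zero]
  -- `c ≤ f 0 y · e^{a(1+‖y‖)³}`
  have hcf : c ≤ f 0 y * Real.exp (a * (1 + ‖y‖) ^ 3) := by
    have h := mul_le_mul_of_nonneg_right (hfloor y) hE.le
    rwa [mul_assoc, hEinv, mul_one] at h
  rw [abs_div, abs_of_pos hf0, div_le_iff₀ hf0]
  have h1 : |f j y| ≤ M₀ := (hCf j y).trans (hM₀j j)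
  -- `M₀ ≤ (M₀/c) · f 0 y · e^{…} ≤ (M₀/c + 1) · e^{…} · f 0 y`
  have h2 : M₀ ≤ M₀ / c * (f 0 y * Real.exp (a * (1 + ‖y‖) ^ 3)) := by
    have := mul_le_mul_of_nonneg_left hcf (div_nonneg hM₀0 hc.le)
    rwa [div_mul_cancel₀ _ hc.ne'] at this
  nlinarith [mul_pos hE hf0]

/-- **On a ball**: `‖y‖ ≤ ρ ⟹ |f_j(y)/f_0(y)| ≤ M · e^{a(1+ρ)³}` with the constants of `exists_ratio_bound`. [cite: CarmonaSimon1981] -/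
theorem ratio_bound_of_norm_le {M a : ℝ} (hM : 0 < M) (ha : 0 < a)
    (h : ∀ (j : Fin (k + 1)) (y : ZM), |f j y / f 0 y| ≤ M * Real.exp (a * (1 + ‖y‖) ^ 3))
    {ρ : ℝ} (j : Fin (k + 1)) {y : ZM} (hy : ‖y‖ ≤ ρ) :
    |f j y / f 0 y| ≤ M * Real.exp (a * (1 + ρ) ^ 3) := by
  refine (h j y).trans (mul_le_mul_of_nonneg_left ?_ hM.le)
  rw [Real.exp_le_exp]
  exact mul_le_mul_of_nonneg_left
    (pow_le_pow_left₀ (by positivity) (by linarith) 3) ha.le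

/-- ★★ **The valley-ratio constant of the transplanted observables as a function of the radius**: there are `M, a > 0` (depending on the eigenfamily only)
with `|transplantFn R f i y| ≤ M · e^{a(1+√2·R)³}` for every `R > 0`, `i`, `y` (`transplantFn R f i = χ_R · f_{i+1}/f_0`, `0 ≤ χ_R ≤ 1`, `χ_R(y) = 0` once
`‖y‖² ≥ 2R²`).  At the r7 radius `R = Λ^{−1/4}`: `C_f ≤ e^{O(Λ^{−3/4})}`. [cite: CarmonaSimon1981] [cite: Luscher1983, §2–§3] -/
theorem exists_transplantFn_bound (hf : IsEigenFamily k f) (hpos : ∀ x, 0 < f 0 x) :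
    ∃ M a : ℝ, 0 < M ∧ 0 < a ∧ ∀ R : ℝ, 0 < R → ∀ (i : Fin k) (y : ZM),
      |transplantFn R f i y| ≤ M * Real.exp (a * (1 + Real.sqrt 2 * R) ^ 3) := by
  obtain ⟨M, a, hM, ha, h⟩ := exists_ratio_bound hf hpos
  refine ⟨M, a, hM, ha, fun R hR i y => ?_⟩
  have hχ := radialCutoff_mem_Icc R y
  have hrhs : 0 ≤ M * Real.exp (a * (1 + Real.sqrt 2 * R) ^ 3) := by positivity
  unfold transplantFn
  rw [abs_mul, abs_of_nonneg hχ.1]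
  by_cases hfar : 2 * R ^ 2 ≤ ‖y‖ ^ 2
  · rw [radialCutoff_eq_zero hR hfar, zero_mul]
    exact hrhs
  · -- inside the support: `‖y‖ < √2 R`
    have hy : ‖y‖ ≤ Real.sqrt 2 * R := by
      have h2 : ‖y‖ ^ 2 ≤ (Real.sqrt 2 * R) ^ 2 := by
        rw [mul_pow, Real.sq_sqrt (by norm_num : (0 : ℝ) ≤ 2)]
        exact (not_le.1 hfar).le
      exact le_of_pow_le_pow_left₀ two_ne_zero (by positivity) h2
    calc radialCutoff R y * |f i.succ y / f 0 y|
        ≤ 1 * (M * Real.exp (a * (1 + Real.sqrt 2 * R) ^ 3)) :=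
          mul_le_mul hχ.2 (ratio_bound_of_norm_le hM ha h i.succ hy) (abs_nonneg _) zero_le_one
      _ = M * Real.exp (a * (1 + Real.sqrt 2 * R) ^ 3) := one_mul _

/-- **The same bound for the one-site observables** `transplantObsL L Λ R f i = transplantFn R f i ∘ rootCoord L (Λ/2)` (any `L`, `Λ`): the sup of a
pull-back is at most the sup. [cite: Luscher1983, §2–§3] -/
theorem exists_transplantObsL_bound (hf : IsEigenFamily k f) (hpos : ∀ x, 0 < f 0 x) :
    ∃ M a : ℝ, 0 < M ∧ 0 < a ∧ ∀ R : ℝ, 0 < R → ∀ (L : ℕ) (Λ : ℝ) (i : Fin k) (U : Cfg),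
      |transplantObsL L Λ R f i U| ≤ M * Real.exp (a * (1 + Real.sqrt 2 * R) ^ 3) := by
  obtain ⟨M, a, hM, ha, h⟩ := exists_transplantFn_bound hf hpos
  exact ⟨M, a, hM, ha, fun R hR L Λ i U => h R hR i _⟩

end Summit.QuantumFields.YangMills.Theorems.FemtoTransferGap.PolyakovLift

end
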